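import Mathlib
import HarnessLib
import Summits.HubbardSuperconductivity.HubbardSuperconductivity.Theorems.KLProgrammeKLRegimeEngineTowerBlockIncrWtPowAtKitCarrier
import Summits.HubbardSuperconductivity.HubbardSuperconductivity.Theorems.KLProgrammeKLRegimeEngineTowerBlockIncrWtKitUnits
import Summits.HubbardSuperconductivity.HubbardSuperconductivity.Theorems.KLProgrammeKLRegimeEngineTowerWtStepLinkUniform

/-!
# Route `KLProgramme` — crux K3 ENGINE (stmt-HubbardSuperconductivity-20437 `KLRegimeEngineV17F2`), stub (b) / E1 interface (E2) in-tower route and located risk #17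
# «(C2)-MOMENTS»: W2 AT WEIGHT POWER `Dw` — THE k-UNIFORM DEGREE-`Dw` WEIGHTED LINK: the born degree-`Dw` array in track-`0` floor units bounded by the kit's
# literal step at k-FREE parameters; the power-`Dw` twin of `…EngineTowerWtStepLinkUniform` §0–§2
# (recipe «(E2)-POW3-TRACK» item T5 «link», HOME/hubbard-kl-k3c3-p2/g19/E2-POW3-TRACK-RECIPE.md; pen g27 (R472)(D), (R479) «LINK/LAW twins»;
#  cell gate-hubbard-kl, seat hubbard-kl-k3c3-p2 g20)

Chain (block `k ≥ 1`, degree `2(q+1)`), VERBATIM the degree-1 file with the carriers `klTowerBornWtPowAt / klTowerMeasWtPowAt … Dw` (✓ …TowerModelDefsWtPowAt) and the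
weights `klScaleWtPow L M β j Dw` in the block data: `klTowerBornWtPowAt_le_kit` (✓ …TowerBlockIncrWtPowAtKitCarrier) put in the kit's dimensionless form
(`towerInputSizes_units`, `kitStep_abs_eq_units_mul` — the step of `klTowerBornWtPowAt_le_kit_units`, …TowerBlockIncrWtPowAtKitUnits, INLINED here) at the INPUT boundary's product units
`u = 8^{dk−1}ε²`, `K_c = (2^{5(dk−1)}ε)⁻¹` (`K_c·u^m = klLevUnitF β M 0 m (dk−1)` for `m ≥ 1`), radius `ρ := κ`, division by the OUTPUT unit
`klLevUnitF β M 0 (q+1) (dk) = K_c·u^{q+1}·8^{q+1}/32`, and `kitStep_abs_eq_units_mul` moving the output constant `(32c̄r/c̄c)·(ε²c̄c²/8)^{q+1}` INTO the measured array.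
At the k-free bounds `κ_k²·8^{dk} ≤ κ̄²`, `α_k ≤ ᾱ·4^{dk}`, degree-`Dw` weighted analysis-overlap rows/cols `≤ c̄r, c̄c`, every parameter is k-INDEPENDENT:
`σ̄ = κ̄²/c̄c²`, `τ̄ = 4e⁴κ̄²/c̄c²`, `ψ̄ = c̄c²/κ̄²`, `Φ̄ = e·ᾱ·c̄c/(κ̄²·c̄r)`, `W̄ = 32c̄r/c̄c`, `Z̄ = ε²c̄c²/8` (the weights are dimensionless: no unit changes).
* §0 `towerMeasWtPowAt_div_units_eq` — the degree-`Dw` carrier quotient in product units IS the floor-unit quotient;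
* §1 **`klTowerBornWtPowAt_succ_le_kitStep_of_bounds`** — blocks `k ≥ 1`: `klTowerBornWtPowAt … d k j Dw (2(q+1)) / klLevUnitF β M 0 (q+1) (dk) ≤ towerFO D σ̄ μ (q+1) +
  Σ_{n∈[2,N]} e·Φ̄^{n−1}·ψ̄^{q+1}·towerS D τ̄ μ n (q+1) + ψ̄^{q+1}·e·V·(Φ̄V)^N/(1−Φ̄V)`, `μ m = W̄·Z̄^m·klTowerMeasWtPowAt … d k j Dw (2m)/klLevUnitF β M 0 m (dk−1)`, guard
  `Φ̄·towerV D τ̄ μ < 1` (`N ≥ 1`);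
* §2 **`wtPowLaw_hstep_of_blockBounds`** — the `hstep` binder of the degree-`Dw` law `klTowerBornWtPowAt_le_law_of_inputs_base_tokX` (…TowerWtPowLawBaseTokX) VERBATIM —
  blocks `1 ≤ k < K_b`, token `Zk k := Z^K_{Λ_{dk}} ≠ 0`, the six names `W Z σ τ ψ Φ` pinned by equational binders (instantiate with `rfl`).
Compositions of landed theorems and real algebra; block constants (`κ`, degree-`Dw` weighted `α`, `cr/cc`) are HYPOTHESES (no supplier row: pen g27 (R465)(E)(iii) STOP
RULE); nothing asserts (E2), (X).3, (b), any stub, K3 or superconductivity.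
References: BGM 2006 §2.8 (2.76)–(2.84), (2.93)–(2.98), §3 (3.2)–(3.8) [cite: BenfattoGiulianiMastropietro2006].
-/

noncomputable section

namespace Summit.HubbardSuperconductivity.HubbardSuperconductivity.Theorems.EngineV8

set_option linter.dupNamespace false -- summit = problem name (single-conjunct summit), D-0017

open Classical
open Real Finset Literature.MathematicalPhysics.QuantumLattice Literature.Probability.LatticeModels GrassmannAlgebra
open Literature.MathematicalPhysics.QuantumLattice.FermiRG
open Summit.HubbardSuperconductivity.HubbardSuperconductivity.Theorems.KLProgrammeLegKernels
open Summit.HubbardSuperconductivity.HubbardSuperconductivity.Theorems.KLRegimeSplit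
open Summit.HubbardSuperconductivity.HubbardSuperconductivity.Theorems.DispersionFlow

variable {L M : ℕ} [NeZero L] [NeZero M]

/-! ## §0 Units bookkeeping for the degree-`Dw` weighted arrays -/

/-- **The degree-`Dw` carrier quotient in the input boundary's product units IS the floor-unit quotient** (as functions; `1 ≤ dk`): with `u = 8^{dk−1}ε²`,
`K_c = ε·(2^{5(dk−1)})⁻¹·(ε²)⁻¹` one has `K_c·u^m = klLevUnitF β M 0 m (dk−1)` for `m ≥ 1`, and both sides vanish in degree `0`.
[cite: BenfattoGiulianiMastropietro2006, §2.8 (2.76)-(2.77)] -/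
theorem towerMeasWtPowAt_div_units_eq {β : ℝ} (hβ : 0 < β) (U μ : ℝ) (K : TrigPolyC4v) (d k j Dw : ℕ) :
    (fun m : ℕ => klTowerMeasWtPowAt L M β U μ K d k j Dw (2 * m) /
        ((imagTimeWeight β M * ((((2 : ℝ) ^ (5 * (d * k - 1))))⁻¹ * (imagTimeWeight β M ^ 2)⁻¹)) *
          ((8 : ℝ) ^ (d * k - 1) * imagTimeWeight β M ^ 2) ^ m)) =
      fun m : ℕ => klTowerMeasWtPowAt L M β U μ K d k j Dw (2 * m) / klLevUnitF β M 0 m (d * k - 1) := by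
  funext m
  rcases Nat.eq_zero_or_pos m with rfl | hm
  · simp [klTowerMeasWtPowAt_zero]
  · rw [klLevUnitF_zero_track_eq_units hβ hm]

/-! ## §1 Blocks `k ≥ 1` at the bounds: k-free parameters -/

/-- **THE DEGREE-`Dw` WEIGHTED BLOCK STEP (`k ≥ 1`) AT k-FREE BOUNDS OF THE BLOCK DATA.**  If the block's Gram constant satisfies `κ²·8^{dk} ≤ κ̄²`, its degree-`Dw`
weighted decay constant `α ≤ ᾱ·4^{dk}`, and its degree-`Dw` weighted analysis-overlap row/column sums are `≤ c̄r`, `≤ c̄c` (weights `klScaleWtPow … j Dw`), then in every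
degree `2(q+1)` the born degree-`Dw` array of `Δ_k` in track-`0` floor units obeys the kit's literal step with the k-INDEPENDENT parameters `σ̄ = κ̄²/c̄c²`,
`τ̄ = 4e⁴κ̄²/c̄c²`, `ψ̄ = c̄c²/κ̄²`, `Φ̄ = e·ᾱ·c̄c/(κ̄²·c̄r)` at the scaled measured array `W̄·Z̄^m·klTowerMeasWtPowAt … d k j Dw (2m)/klLevUnitF β M 0 m (dk−1)`, `W̄ = 32c̄r/c̄c`,
`Z̄ = ε²c̄c²/8`. [cite: BenfattoGiulianiMastropietro2006, §2.8 (2.76)-(2.84), §3 (3.2)-(3.8)] -/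
theorem klTowerBornWtPowAt_succ_le_kitStep_of_bounds {β : ℝ} (hβ : 0 < β) (U μ : ℝ) (K : TrigPolyC4v) {d k : ℕ} (j Dw : ℕ) (hd : 1 ≤ d) (hk : 1 ≤ k)
    (hZ : hubbardEffPartitionFnCT L M β U μ 0 K (klScale klE0 (d * k)) ≠ 0)
    {κ κb : ℝ} (hκ : 0 < κ) (hκb : 0 < κb) (hκκb : κ ^ 2 * (8 : ℝ) ^ (d * k) ≤ κb ^ 2)
    (hGB : IsGramBoundedR ((sectorSubMatrix L M β (bgmFatMultiplier L M klE0 β (nambuXiCT L μ K) (d * k - 1))).transpose *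
      hubbardCovSliceCT L M β μ 0 K (klScale klE0 (d * (k + 1))) (klScale klE0 (d * k)) *
        sectorSubMatrix L M β (bgmFatMultiplier L M klE0 β (nambuXiCT L μ K) (d * k - 1))) κ)
    {α αb : ℝ} (hαb : 0 < αb) (hααb : α ≤ αb * (4 : ℝ) ^ (d * k))
    (hrow : ∀ X, ∑ Y, ‖((sectorSubMatrix L M β (bgmFatMultiplier L M klE0 β (nambuXiCT L μ K) (d * k - 1))).transpose *
        hubbardCovSliceCT L M β μ 0 K (klScale klE0 (d * (k + 1))) (klScale klE0 (d * k)) *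
          sectorSubMatrix L M β (bgmFatMultiplier L M klE0 β (nambuXiCT L μ K) (d * k - 1))) X Y‖ *
        klScaleWtPow L M β j Dw {latticeLegPos (2 * (2 * M)) X, latticeLegPos (2 * (2 * M)) Y} ≤ α)
    (hcol : ∀ Y, ∑ X, ‖((sectorSubMatrix L M β (bgmFatMultiplier L M klE0 β (nambuXiCT L μ K) (d * k - 1))).transpose *
        hubbardCovSliceCT L M β μ 0 K (klScale klE0 (d * (k + 1))) (klScale klE0 (d * k)) *
          sectorSubMatrix L M β (bgmFatMultiplier L M klE0 β (nambuXiCT L μ K) (d * k - 1))) X Y‖ *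
        klScaleWtPow L M β j Dw {latticeLegPos (2 * (2 * M)) X, latticeLegPos (2 * (2 * M)) Y} ≤ α)
    {crb ccb : ℝ} (hcrb : 0 < crb) (hccb : 0 < ccb)
    (hrow' : ∀ X'', ∑ X', ‖(sectorAnalysisMatrix L M β (klAnisoFamily L M β μ K klE0 (d * k)) *
        sectorSubMatrix L M β (bgmFatMultiplier L M klE0 β (nambuXiCT L μ K) (d * k - 1))) X'' X'‖ *
        klScaleWtPow L M β j Dw {latticeLegPos (2 * (2 * M)) X'', latticeLegPos (2 * (2 * M)) X'} ≤ crb)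
    (hcol' : ∀ X', ∑ X'', ‖(sectorAnalysisMatrix L M β (klAnisoFamily L M β μ K klE0 (d * k)) *
        sectorSubMatrix L M β (bgmFatMultiplier L M klE0 β (nambuXiCT L μ K) (d * k - 1))) X'' X'‖ *
        klScaleWtPow L M β j Dw {latticeLegPos (2 * (2 * M)) X'', latticeLegPos (2 * (2 * M)) X'} ≤ ccb)
    {D : ℕ} (hD : Fintype.card (SpaceTimeIdx L M × SectorLeg (sectorCount (d * k - 1))) / 2 ≤ D)
    {N : ℕ} (hN : 1 ≤ N)
    (hguard : exp 1 * αb * ccb / (κb ^ 2 * crb) *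
      towerV D (4 * exp 4 * κb ^ 2 / ccb ^ 2)
        (fun m => 32 * crb / ccb * (imagTimeWeight β M ^ 2 * ccb ^ 2 / 8) ^ m *
          (klTowerMeasWtPowAt L M β U μ K d k j Dw (2 * m) / klLevUnitF β M 0 m (d * k - 1))) < 1)
    (q : ℕ) :
    klTowerBornWtPowAt L M β U μ K d k j Dw (2 * (q + 1)) / klLevUnitF β M 0 (q + 1) (d * k) ≤
      towerFO D (κb ^ 2 / ccb ^ 2)
          (fun m => 32 * crb / ccb * (imagTimeWeight β M ^ 2 * ccb ^ 2 / 8) ^ m *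
            (klTowerMeasWtPowAt L M β U μ K d k j Dw (2 * m) / klLevUnitF β M 0 m (d * k - 1))) (q + 1) +
        ∑ n ∈ Icc 2 N, exp 1 * (exp 1 * αb * ccb / (κb ^ 2 * crb)) ^ (n - 1) * (ccb ^ 2 / κb ^ 2) ^ (q + 1) *
          towerS D (4 * exp 4 * κb ^ 2 / ccb ^ 2)
            (fun m => 32 * crb / ccb * (imagTimeWeight β M ^ 2 * ccb ^ 2 / 8) ^ m *
              (klTowerMeasWtPowAt L M β U μ K d k j Dw (2 * m) / klLevUnitF β M 0 m (d * k - 1))) n (q + 1) +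
        (ccb ^ 2 / κb ^ 2) ^ (q + 1) * exp 1 *
          towerV D (4 * exp 4 * κb ^ 2 / ccb ^ 2)
            (fun m => 32 * crb / ccb * (imagTimeWeight β M ^ 2 * ccb ^ 2 / 8) ^ m *
              (klTowerMeasWtPowAt L M β U μ K d k j Dw (2 * m) / klLevUnitF β M 0 m (d * k - 1))) *
          (exp 1 * αb * ccb / (κb ^ 2 * crb) *
            towerV D (4 * exp 4 * κb ^ 2 / ccb ^ 2)
              (fun m => 32 * crb / ccb * (imagTimeWeight β M ^ 2 * ccb ^ 2 / 8) ^ m *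
                (klTowerMeasWtPowAt L M β U μ K d k j Dw (2 * m) / klLevUnitF β M 0 m (d * k - 1)))) ^ N /
          (1 - exp 1 * αb * ccb / (κb ^ 2 * crb) *
            towerV D (4 * exp 4 * κb ^ 2 / ccb ^ 2)
              (fun m => 32 * crb / ccb * (imagTimeWeight β M ^ 2 * ccb ^ 2 / 8) ^ m *
                (klTowerMeasWtPowAt L M β U μ K d k j Dw (2 * m) / klLevUnitF β M 0 m (d * k - 1)))) := by
  have hx : 0 < imagTimeWeight β M := imagTimeWeight_pos_of_pos (M := M) hβ
  have hJ₁ : 1 ≤ d * k := le_trans hk (Nat.le_mul_of_pos_left k (by omega))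
  have h8 : (0 : ℝ) < (8 : ℝ) ^ (d * k) := by positivity
  have he1 : 0 < exp 1 := exp_pos 1
  have he4' : exp 4 = exp 2 ^ 2 := by rw [← Real.exp_nat_mul]; norm_num
  -- the Gram constant at the bound: `κ′ ≥ κ`, `κ′²·8^{dk} = κ̄²`
  obtain ⟨κ', hκ'0, hκκ', hκ'sq⟩ := exists_sqrt_scaled hκ hκb h8 hκκb
  have hGB' := TorusFourierL2.isGramBoundedR_of_le hGB hκ.le hκκ'
  -- the decay constant at the bound
  have hα'0 : 0 < αb * (4 : ℝ) ^ (d * k) := by positivity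
  have hrow2 : ∀ X, ∑ Y, ‖((sectorSubMatrix L M β (bgmFatMultiplier L M klE0 β (nambuXiCT L μ K) (d * k - 1))).transpose *
      hubbardCovSliceCT L M β μ 0 K (klScale klE0 (d * (k + 1))) (klScale klE0 (d * k)) *
        sectorSubMatrix L M β (bgmFatMultiplier L M klE0 β (nambuXiCT L μ K) (d * k - 1))) X Y‖ *
        klScaleWtPow L M β j Dw {latticeLegPos (2 * (2 * M)) X, latticeLegPos (2 * (2 * M)) Y} ≤ αb * (4 : ℝ) ^ (d * k) :=
    fun X => (hrow X).trans hααb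
  have hcol2 : ∀ Y, ∑ X, ‖((sectorSubMatrix L M β (bgmFatMultiplier L M klE0 β (nambuXiCT L μ K) (d * k - 1))).transpose *
      hubbardCovSliceCT L M β μ 0 K (klScale klE0 (d * (k + 1))) (klScale klE0 (d * k)) *
        sectorSubMatrix L M β (bgmFatMultiplier L M klE0 β (nambuXiCT L μ K) (d * k - 1))) X Y‖ *
        klScaleWtPow L M β j Dw {latticeLegPos (2 * (2 * M)) X, latticeLegPos (2 * (2 * M)) Y} ≤ αb * (4 : ℝ) ^ (d * k) :=
    fun Y => (hcol Y).trans hααb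
  -- abbreviations: the input boundary's units, the unit-free measured array, the parameters
  set ε : ℝ := imagTimeWeight β M with hε
  set Kc : ℝ := ε * ((((2 : ℝ) ^ (5 * (d * k - 1))))⁻¹ * (ε ^ 2)⁻¹) with hKc
  set u : ℝ := (8 : ℝ) ^ (d * k - 1) * ε ^ 2 with hu
  set μ₁ : ℕ → ℝ := fun m => klTowerMeasWtPowAt L M β U μ K d k j Dw (2 * m) / klLevUnitF β M 0 m (d * k - 1) with hμ₁
  set W : ℝ := 32 * crb / ccb with hW
  set Z : ℝ := ε ^ 2 * ccb ^ 2 / 8 with hZ'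
  set σb : ℝ := κb ^ 2 / ccb ^ 2 with hσb
  set τb : ℝ := 4 * exp 4 * κb ^ 2 / ccb ^ 2 with hτb
  set ψb : ℝ := ccb ^ 2 / κb ^ 2 with hψb
  set Φb : ℝ := exp 1 * αb * ccb / (κb ^ 2 * crb) with hΦb
  have hKc0 : 0 < Kc := by positivity
  have hu0 : 0 < u := by positivity
  have hW0 : 0 < W := by positivity
  have hZ0 : 0 < Z := by positivity
  have hμ₁0 : ∀ m, 0 ≤ μ₁ m := fun m =>
    div_nonneg (klTowerMeasWtPowAt_nonneg hβ.le U μ K d k j Dw (2 * m)) (klLevUnitF_pos hβ 0 m (d * k - 1)).le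
  -- `8^{dk} = 8^{dk−1}·8`, `4^{dk} = 4^{dk−1}·4`, `2^{5(dk−1)} = 4^{dk−1}·8^{dk−1}`
  have h8succ : (8 : ℝ) ^ (d * k) = (8 : ℝ) ^ (d * k - 1) * 8 := by rw [← pow_succ, Nat.sub_add_cancel hJ₁]
  have h4succ : (4 : ℝ) ^ (d * k) = (4 : ℝ) ^ (d * k - 1) * 4 := by rw [← pow_succ, Nat.sub_add_cancel hJ₁]
  have h32 : (2 : ℝ) ^ (5 * (d * k - 1)) = (4 : ℝ) ^ (d * k - 1) * (8 : ℝ) ^ (d * k - 1) := by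
    rw [← mul_pow, show (4 : ℝ) * 8 = 2 ^ 5 by norm_num, ← pow_mul]
  have h8p : (0 : ℝ) < (8 : ℝ) ^ (d * k - 1) := by positivity
  have h4p : (0 : ℝ) < (4 : ℝ) ^ (d * k - 1) := by positivity
  -- the carrier quotient in product units is `μ₁`; the absolute input sizes are `(ε·K_c)·(u^m·μ₁ m)`
  have hμeq : (fun m : ℕ => klTowerMeasWtPowAt L M β U μ K d k j Dw (2 * m) / (Kc * u ^ m)) = μ₁ := by
    rw [hμ₁, hKc, hu, hε]; exact towerMeasWtPowAt_div_units_eq hβ U μ K d k j Dw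
  have habs : (fun m : ℕ => imagTimeWeight β M * klTowerMeasWtPowAt L M β U μ K d k j Dw (2 * m)) =
      fun m : ℕ => (ε * Kc) * (u ^ m * μ₁ m) := by
    rw [← hμeq]; exact towerInputSizes_units (ε := ε) hu0.ne' hKc0.ne' (fun m => klTowerMeasWtPowAt L M β U μ K d k j Dw m)
  -- the scaled array in product form
  have hμbar : (fun m : ℕ => 32 * crb / ccb * (imagTimeWeight β M ^ 2 * ccb ^ 2 / 8) ^ m *
      (klTowerMeasWtPowAt L M β U μ K d k j Dw (2 * m) / klLevUnitF β M 0 m (d * k - 1))) = fun m : ℕ => W * (Z ^ m * μ₁ m) := by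
    funext m; simp only [hW, hZ', hμ₁, hε]; ring
  -- the four parameter identities and the output constant
  have hσeq : σb * Z = κ' ^ 2 * u := by
    simp only [hσb, hZ', hu]; rw [← hκ'sq, h8succ]; field_simp
  have hτeq : τb * Z = (exp 2 * (κ' + κ')) ^ 2 * u := by
    simp only [hτb, hZ', hu]; rw [← hκ'sq, h8succ, he4']; field_simp; ring
  have hψeq : ψb / Z = κ'⁻¹ ^ 2 / u := by
    simp only [hψb, hZ', hu]; rw [← hκ'sq, h8succ, inv_pow]; field_simp
  have hΦeq : Φb * W = exp 1 * (αb * (4 : ℝ) ^ (d * k)) / κ' ^ 2 * (ε * Kc) := by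
    simp only [hΦb, hW, hKc]
    rw [← hκ'sq, h8succ, h4succ, h32]
    field_simp
    ring
  -- the guard of the kit form, from the final guard
  have hguardkit : exp 1 * (αb * (4 : ℝ) ^ (d * k)) / κ' ^ 2 *
      towerV D ((exp 2 * (κ' + κ')) ^ 2) (fun m' => imagTimeWeight β M * klTowerMeasWtPowAt L M β U μ K d k j Dw (2 * m')) < 1 := by
    have key : exp 1 * (αb * (4 : ℝ) ^ (d * k)) / κ' ^ 2 *
        towerV D ((exp 2 * (κ' + κ')) ^ 2) (fun m' => imagTimeWeight β M * klTowerMeasWtPowAt L M β U μ K d k j Dw (2 * m')) =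
        Φb * towerV D τb (fun m => 32 * crb / ccb * (imagTimeWeight β M ^ 2 * ccb ^ 2 / 8) ^ m *
          (klTowerMeasWtPowAt L M β U μ K d k j Dw (2 * m) / klLevUnitF β M 0 m (d * k - 1))) := by
      rw [habs, hμbar, towerV_units, towerV_units, hτeq]
      calc exp 1 * (αb * (4 : ℝ) ^ (d * k)) / κ' ^ 2 * ((ε * Kc) * towerV D ((exp 2 * (κ' + κ')) ^ 2 * u) μ₁)
          = (exp 1 * (αb * (4 : ℝ) ^ (d * k)) / κ' ^ 2 * (ε * Kc)) * towerV D ((exp 2 * (κ' + κ')) ^ 2 * u) μ₁ := by ring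
        _ = (Φb * W) * towerV D ((exp 2 * (κ' + κ')) ^ 2 * u) μ₁ := by rw [hΦeq]
        _ = Φb * (W * towerV D ((exp 2 * (κ' + κ')) ^ 2 * u) μ₁) := by ring
    rw [key]; exact hguard
  -- (1) the kit form at the input boundary's units, truncation `N + 1`, radius `ρ := κ′` (the step of `klTowerBornWtPowAt_le_kit_units`, inlined)
  have hN₁ : 2 ≤ N + 1 := by omega
  have h0 := klTowerBornWtPowAt_le_kit (L := L) (M := M) hβ U μ K j Dw hd hk hZ hκ'0 hGB' hα'0 hrow2 hcol2 hκ'0 hD hguardkit hcrb.le hccb.le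
    hrow' hcol' hN₁ q
  rw [habs, kitStep_abs_eq_units_mul (mul_ne_zero hx.ne' hKc0.ne') hu0.ne', Nat.add_sub_cancel, hε] at h0
  have h1 : klTowerBornWtPowAt L M β U μ K d k j Dw (2 * (q + 1)) ≤
      (imagTimeWeight β M * crb) * (imagTimeWeight β M * ccb) ^ (2 * q + 1) * (u ^ (q + 1) * Kc) *
        (towerFO D (κ' ^ 2 * u) μ₁ (q + 1) +
          ∑ n ∈ Icc 2 N, exp 1 * (exp 1 * (αb * (4 : ℝ) ^ (d * k)) / κ' ^ 2 * (imagTimeWeight β M * Kc)) ^ (n - 1) * (κ'⁻¹ ^ 2 / u) ^ (q + 1) *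
            towerS D ((exp 2 * (κ' + κ')) ^ 2 * u) μ₁ n (q + 1) +
          (κ'⁻¹ ^ 2 / u) ^ (q + 1) * exp 1 * towerV D ((exp 2 * (κ' + κ')) ^ 2 * u) μ₁ *
            (exp 1 * (αb * (4 : ℝ) ^ (d * k)) / κ' ^ 2 * (imagTimeWeight β M * Kc) * towerV D ((exp 2 * (κ' + κ')) ^ 2 * u) μ₁) ^ N /
            (1 - exp 1 * (αb * (4 : ℝ) ^ (d * k)) / κ' ^ 2 * (imagTimeWeight β M * Kc) * towerV D ((exp 2 * (κ' + κ')) ^ 2 * u) μ₁)) :=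
    h0.trans (le_of_eq (by ring))
  -- (2) the final kit bracket in the input units: `kit(W̄·Z̄^m·μ₁; σ̄, τ̄, Φ̄, ψ̄) = (Z̄^{q+1}·W̄)·kit(μ₁; κ′²u, τ′u, Φ̂, ψ̂)`
  have hkit := kitStep_abs_eq_units_mul (K := W) (u := Z) hW0.ne' hZ0.ne' D σb τb Φb ψb μ₁ N (q + 1)
  rw [hσeq, hτeq, hΦeq, hψeq] at hkit
  -- (3) divide by the output unit
  have hunit : klLevUnitF β M 0 (q + 1) (d * k) = (Kc * u ^ (q + 1)) * ((8 : ℝ) ^ (q + 1) / 32) := by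
    rw [hKc, hu, hε]; exact klLevUnitF_zero_track_succ_units (M := M) hβ hJ₁ (by omega)
  have hU0 : 0 < klLevUnitF β M 0 (q + 1) (d * k) := klLevUnitF_pos hβ 0 _ _
  have hout : (imagTimeWeight β M * crb) * (imagTimeWeight β M * ccb) ^ (2 * q + 1) * (u ^ (q + 1) * Kc) =
      (Z ^ (q + 1) * W) * ((Kc * u ^ (q + 1)) * ((8 : ℝ) ^ (q + 1) / 32)) := by
    simp only [hZ', hW, hε, div_pow, mul_pow, ← pow_mul]
    field_simp
    ring
  rw [hμbar, hkit, div_le_iff₀ hU0, hunit]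
  refine h1.trans (le_of_eq ?_)
  rw [hout]
  ring

/-! ## §2 The `hstep` binder of the degree-`Dw` law, uniformly in the block -/

/-- **THE k-UNIFORM DEGREE-`Dw` WEIGHTED LINK**: the `hstep` binder of `klTowerBornWtPowAt_le_law_of_inputs_base_tokX` (…TowerWtPowLawBaseTokX) VERBATIM — blocks
`1 ≤ k < K_b`, token `Zk k := Z^K_{Λ_{dk}} ≠ 0`, the law's six names `W Z σ τ ψ Φ` pinned by equations (instantiate each with `rfl`) to `W = 32c̄r/c̄c`,
`Z = ε²c̄c²/8`, `σ = κ̄²/c̄c²`, `τ = 4e⁴κ̄²/c̄c²`, `ψ = c̄c²/κ̄²`, `Φ = e·ᾱ·c̄c/(κ̄²·c̄r)` — from the per-block Gram, degree-`Dw` weighted decay and weighted overlap data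
under the k-free bounds `κ_k²·8^{dk} ≤ κ̄²`, `α_k ≤ ᾱ·4^{dk}`, overlap sums `≤ c̄r, c̄c`, and `card/2 ≤ D` at every block.
[cite: BenfattoGiulianiMastropietro2006, §2.8 (2.76)-(2.84), §3 (3.2)-(3.8)] -/
theorem wtPowLaw_hstep_of_blockBounds {β : ℝ} (hβ : 0 < β) (U μ : ℝ) (K : TrigPolyC4v) {d : ℕ} (hd : 1 ≤ d) (j Dw Kb : ℕ)
    {κb αb crb ccb : ℝ} (hκb : 0 < κb) (hαb : 0 < αb) (hcrb : 0 < crb) (hccb : 0 < ccb)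
    (κ α : ℕ → ℝ) (hκ : ∀ k, 1 ≤ k → k < Kb → 0 < κ k) (hκκb : ∀ k, 1 ≤ k → k < Kb → κ k ^ 2 * (8 : ℝ) ^ (d * k) ≤ κb ^ 2)
    (hααb : ∀ k, 1 ≤ k → k < Kb → α k ≤ αb * (4 : ℝ) ^ (d * k))
    (hGB : ∀ k, 1 ≤ k → k < Kb → IsGramBoundedR ((sectorSubMatrix L M β (bgmFatMultiplier L M klE0 β (nambuXiCT L μ K) (d * k - 1))).transpose *
      hubbardCovSliceCT L M β μ 0 K (klScale klE0 (d * (k + 1))) (klScale klE0 (d * k)) *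
        sectorSubMatrix L M β (bgmFatMultiplier L M klE0 β (nambuXiCT L μ K) (d * k - 1))) (κ k))
    (hrow : ∀ k, 1 ≤ k → k < Kb → ∀ X, ∑ Y, ‖((sectorSubMatrix L M β (bgmFatMultiplier L M klE0 β (nambuXiCT L μ K) (d * k - 1))).transpose *
        hubbardCovSliceCT L M β μ 0 K (klScale klE0 (d * (k + 1))) (klScale klE0 (d * k)) *
          sectorSubMatrix L M β (bgmFatMultiplier L M klE0 β (nambuXiCT L μ K) (d * k - 1))) X Y‖ *
        klScaleWtPow L M β j Dw {latticeLegPos (2 * (2 * M)) X, latticeLegPos (2 * (2 * M)) Y} ≤ α k)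
    (hcol : ∀ k, 1 ≤ k → k < Kb → ∀ Y, ∑ X, ‖((sectorSubMatrix L M β (bgmFatMultiplier L M klE0 β (nambuXiCT L μ K) (d * k - 1))).transpose *
        hubbardCovSliceCT L M β μ 0 K (klScale klE0 (d * (k + 1))) (klScale klE0 (d * k)) *
          sectorSubMatrix L M β (bgmFatMultiplier L M klE0 β (nambuXiCT L μ K) (d * k - 1))) X Y‖ *
        klScaleWtPow L M β j Dw {latticeLegPos (2 * (2 * M)) X, latticeLegPos (2 * (2 * M)) Y} ≤ α k)
    (hrow' : ∀ k, 1 ≤ k → k < Kb → ∀ X'', ∑ X', ‖(sectorAnalysisMatrix L M β (klAnisoFamily L M β μ K klE0 (d * k)) *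
        sectorSubMatrix L M β (bgmFatMultiplier L M klE0 β (nambuXiCT L μ K) (d * k - 1))) X'' X'‖ *
        klScaleWtPow L M β j Dw {latticeLegPos (2 * (2 * M)) X'', latticeLegPos (2 * (2 * M)) X'} ≤ crb)
    (hcol' : ∀ k, 1 ≤ k → k < Kb → ∀ X', ∑ X'', ‖(sectorAnalysisMatrix L M β (klAnisoFamily L M β μ K klE0 (d * k)) *
        sectorSubMatrix L M β (bgmFatMultiplier L M klE0 β (nambuXiCT L μ K) (d * k - 1))) X'' X'‖ *
        klScaleWtPow L M β j Dw {latticeLegPos (2 * (2 * M)) X'', latticeLegPos (2 * (2 * M)) X'} ≤ ccb)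
    {D : ℕ} (hD : ∀ k, 1 ≤ k → k < Kb → Fintype.card (SpaceTimeIdx L M × SectorLeg (sectorCount (d * k - 1))) / 2 ≤ D)
    (W Z σ τ ψ Φ : ℝ) (hW : W = 32 * crb / ccb) (hZ : Z = imagTimeWeight β M ^ 2 * ccb ^ 2 / 8)
    (hσ : σ = κb ^ 2 / ccb ^ 2) (hτ : τ = 4 * exp 4 * κb ^ 2 / ccb ^ 2) (hψ : ψ = ccb ^ 2 / κb ^ 2)
    (hΦ : Φ = exp 1 * αb * ccb / (κb ^ 2 * crb)) :
    ∀ k, 1 ≤ k → k < Kb → hubbardEffPartitionFnCT L M β U μ 0 K (klScale klE0 (d * k)) ≠ 0 → ∀ N : ℕ, 2 ≤ N → ∀ p, 3 ≤ p → p ≤ D →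
      Φ * towerV D τ (fun m => W * Z ^ m * (klTowerMeasWtPowAt L M β U μ K d k j Dw (2 * m) / klLevUnitF β M 0 m (d * k - 1))) < 1 →
      klTowerBornWtPowAt L M β U μ K d k j Dw (2 * p) / klLevUnitF β M 0 p (d * k) ≤
        towerFO D σ (fun m => W * Z ^ m * (klTowerMeasWtPowAt L M β U μ K d k j Dw (2 * m) / klLevUnitF β M 0 m (d * k - 1))) p +
          ∑ n ∈ Icc 2 N, exp 1 * Φ ^ (n - 1) * ψ ^ p *
            towerS D τ (fun m => W * Z ^ m * (klTowerMeasWtPowAt L M β U μ K d k j Dw (2 * m) / klLevUnitF β M 0 m (d * k - 1))) n p +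
          ψ ^ p * exp 1 * towerV D τ (fun m => W * Z ^ m * (klTowerMeasWtPowAt L M β U μ K d k j Dw (2 * m) / klLevUnitF β M 0 m (d * k - 1))) *
            (Φ * towerV D τ (fun m => W * Z ^ m * (klTowerMeasWtPowAt L M β U μ K d k j Dw (2 * m) / klLevUnitF β M 0 m (d * k - 1)))) ^ N /
            (1 - Φ * towerV D τ (fun m => W * Z ^ m * (klTowerMeasWtPowAt L M β U μ K d k j Dw (2 * m) / klLevUnitF β M 0 m (d * k - 1)))) := by
  intro k hk1 hkK hZk N hN p hp hpD hguard
  subst hW hZ hσ hτ hψ hΦ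
  obtain ⟨q, rfl⟩ : ∃ q, p = q + 1 := ⟨p - 1, by omega⟩
  exact klTowerBornWtPowAt_succ_le_kitStep_of_bounds hβ U μ K j Dw hd hk1 hZk (hκ k hk1 hkK) hκb (hκκb k hk1 hkK) (hGB k hk1 hkK) hαb (hααb k hk1 hkK)
    (hrow k hk1 hkK) (hcol k hk1 hkK) hcrb hccb (hrow' k hk1 hkK) (hcol' k hk1 hkK) (hD k hk1 hkK) (by omega) hguard q

end Summit.HubbardSuperconductivity.HubbardSuperconductivity.Theorems.EngineV8

end
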